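import Mathlib.NumberTheory.Real.Irrational
import Mathlib.Algebra.Order.Floor.Semiring
import Mathlib.Data.Finset.Lattice.Fold
import Mathlib.Algebra.Group.Pointwise.Finset.Basic
import Mathlib.Tactic.LinearCombination
import Mathlib.Tactic.Positivity
import Mathlib.Tactic.FieldSimp
import HarnessLib

/-!
# Connes–Consani, *Geometry of the arithmetic site* (2016), §6.3 / §7.1: the Frobenius
# correspondences `ℱ(λ)`, their range semirings `ℛ(λ)` and the rigidity
# "`ℛ(λ) ≅ ℛ(λ')` iff `λ' ∈ {λ, 1/λ}`" (Proposition 6.13) — PROVED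

Topic `Literature/NumberTheory/ConnesConsani`. Source: A. Connes, C. Consani, *Geometry of the
arithmetic site*, Adv. Math. 291 (2016) 274–329 = arXiv:1502.05580 [bib
`ConnesConsani2016ArithmeticSite`], §6.3 "The Frobenius correspondences on `𝒜`" and §7.1 "Reduced
correspondences" (Adv. Math. numbering). Companion of `ArithmeticSite.lean` (the curve `𝒜`, its
points and stalks); this file types the first SQUARE-level objects of the programme — the graphs of
Frobenius `Ψ(λ)` as semirings — which the cell's autopsy (HOME CC-MAP §2.3, LOCATED-GAP items 6–7)
lists as the only square-level structures constructed in print.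

## The statements, verbatim

* **Proposition 6.13.** "(i) Let `λ ∈ ℝ₊*` and `q ∈ (0,1)`, then the following defines a homomorphism
  of semirings `ℱ(λ,q) : ℤ_min ⊗_𝔹 ℤ_min → ℝ₊^max`,
  `ℱ(λ,q)(Σ q^{n_i} ⊗_𝔹 q^{m_i}) = q^α`, `α = inf (λn_i + m_i)`. (ii) The semiring
  `ℛ(λ) := ℱ(λ,q)(ℤ_min⁺ ⊗_𝔹 ℤ_min⁺)` does not depend, up to canonical isomorphism, of the choice
  of `q ∈ (0,1)`. (iii) The semirings `ℛ(λ)` and `ℛ(λ')`, for `λ, λ' ∉ ℚ₊*`, are isomorphic if and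
  only if `λ' = λ` or `λ' = 1/λ`." Proof of (i): "We use the identification of `ℤ_min ⊗_𝔹 ℤ_min`
  with `Sub(ℤ × ℤ)` for which the two operations are given by the union `E ∪ E'` and the sum
  `E + E'` […] `ℱ(λ,q)(E) = q^α`, `α = inf_{x ∈ E} L_λ(x)`", `L_λ(a,b) := λa + b`. Proof of (iii):
  "As a monoïd, it contains two elements `X, Y` which are indecomposable as products (and are
  `≠ 1`) […] `X^a < Y^b` if and only if `λa > b` […] Thus one recovers from the semiring `ℛ(λ)` the
  Dedekind cut which defines `λ`. The choice of the other of the two generators replaces `λ` by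
  `1/λ`."
* §7.1: "the elements of `ℛ(λ)` are powers `q^α`, where `α ∈ ℕ + λℕ` and the morphisms `ℓ(λ)` and
  `r(λ)` are described as follows `ℓ(λ)(q^n)q^α = q^{α+nλ}`, `r(λ)(q^n)q^α = q^{α+n}`" (eq. (58));
  "`Ψ(λ) := (R, ℓ(λ), r(λ))`, `R := ℛ(λ)`" (eq. (57)), a reduced correspondence (Definition 7.1).

## Rendering (exponent coordinates)
Writing every element of `ℝ₊^max ∖ {0}` as `q^α` (`q ∈ (0,1)` fixed), the "addition" (max) of
`ℝ₊^max` becomes `min` on exponents and the multiplication becomes `+`; this presentation is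
manifestly independent of `q`, which is the content of (ii). So: `ℛ(λ)` = the set `ℕλ + ℕ ⊂ ℝ`
(`frobRange λ`) with the operations `(min, +)`; `ℱ(λ)` on a finite non-empty `E ⊂ ℕ × ℕ` (an
element of `ℤ_min⁺ ⊗_𝔹 ℤ_min⁺ ⊂ Sub(ℤ × ℤ)`) is `inf_{(a,b) ∈ E} (λa + b)` (`frobEval λ E`); a
semiring isomorphism `ℛ(λ) ≅ ℛ(λ')` is a bijection `ℕλ + ℕ → ℕλ' + ℕ` preserving `+` and `min`
(`IsMinPlusIso`). Everything below is proved; there are no named facts. NOT typed here: the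
topos-level objects (`ℤ_min ⊗_𝔹 ℤ_min` as a 𝔹-module in `ℕ̂^{×2}`, Def. 6.10), the composition of
correspondences and its law Theorem 7.7 (tensor products `ℛ(λ) ⊗_{ℤ_min⁺} ℛ(λ')`, §7.2–7.4).
-/

noncomputable section

open Set

namespace Literature.NumberTheory.ConnesConsani

/-! ## `ℛ(λ) = ℕλ + ℕ` with `(min, +)` -/

/-- **The range semiring `ℛ(λ)` of the Frobenius correspondence**, in exponent coordinates: "the
elements of `ℛ(λ)` are powers `q^α`, where `α ∈ ℕ + λℕ`" (§7.1); the semiring operations of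
`ℝ₊^max` read `min` and `+` on `α`. [cite: ConnesConsani2016ArithmeticSite, Prop. 6.13 (ii) and §7.1 (before eq. (58))] -/
def frobRange (l : ℝ) : Set ℝ :=
  {α | ∃ n m : ℕ, α = n * l + m}

/-- `nλ + m ∈ ℛ(λ)`. [cite: ConnesConsani2016ArithmeticSite, §7.1] -/
theorem mem_frobRange (l : ℝ) (n m : ℕ) : (n : ℝ) * l + m ∈ frobRange l := ⟨n, m, rfl⟩

/-- `0 ∈ ℛ(λ)` (the unit `q^0` of the multiplication). [cite: ConnesConsani2016ArithmeticSite, §7.1] -/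
theorem zero_mem_frobRange (l : ℝ) : (0 : ℝ) ∈ frobRange l := ⟨0, 0, by simp⟩

/-- The generator `X = q^λ`: `λ ∈ ℛ(λ)`. [cite: ConnesConsani2016ArithmeticSite, Prop. 6.13 (proof of (iii): "X = q^λ")] -/
theorem self_mem_frobRange (l : ℝ) : l ∈ frobRange l := ⟨1, 0, by simp⟩

/-- The generator `Y = q`: `1 ∈ ℛ(λ)`. [cite: ConnesConsani2016ArithmeticSite, Prop. 6.13 (proof of (iii): "Y = q")] -/
theorem one_mem_frobRange (l : ℝ) : (1 : ℝ) ∈ frobRange l := ⟨0, 1, by simp⟩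

/-- `ℛ(λ)` is closed under `+` (the multiplication `q^α q^β = q^{α+β}`).
[cite: ConnesConsani2016ArithmeticSite, Prop. 6.13 (i)–(ii)] -/
theorem add_mem_frobRange {l a b : ℝ} (ha : a ∈ frobRange l) (hb : b ∈ frobRange l) :
    a + b ∈ frobRange l := by
  obtain ⟨n, m, rfl⟩ := ha
  obtain ⟨n', m', rfl⟩ := hb
  exact ⟨n + n', m + m', by push_cast; ring⟩

/-- `ℛ(λ)` is closed under `min` (the addition of `ℝ₊^max`, a total order).
[cite: ConnesConsani2016ArithmeticSite, Prop. 6.13 (proof of (iii): "a totally ordered set using its additive structure")] -/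
theorem min_mem_frobRange {l a b : ℝ} (ha : a ∈ frobRange l) (hb : b ∈ frobRange l) :
    min a b ∈ frobRange l := by
  rcases le_total a b with h | h
  · rwa [min_eq_left h]
  · rwa [min_eq_right h]

/-- `ℕ`-multiples: `nλ ∈ ℛ(λ)` and `m ∈ ℛ(λ)`. [cite: ConnesConsani2016ArithmeticSite, §7.1] -/
theorem nat_mul_mem_frobRange (l : ℝ) (n : ℕ) : (n : ℝ) * l ∈ frobRange l := ⟨n, 0, by simp⟩

/-- `m ∈ ℛ(λ)`. [cite: ConnesConsani2016ArithmeticSite, §7.1] -/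
theorem nat_mem_frobRange (l : ℝ) (m : ℕ) : (m : ℝ) ∈ frobRange l := ⟨0, m, by simp⟩

/-- **The two structure morphisms of `Ψ(λ)`** (eq. (58)): `ℓ(λ)(q^n) : q^α ↦ q^{α+nλ}` and
`r(λ)(q^n) : q^α ↦ q^{α+n}` preserve `ℛ(λ)`. [cite: ConnesConsani2016ArithmeticSite, §7.1 eq. (58)] -/
theorem ell_r_mem_frobRange {l α : ℝ} (hα : α ∈ frobRange l) (n : ℕ) :
    α + n * l ∈ frobRange l ∧ α + n ∈ frobRange l :=
  ⟨add_mem_frobRange hα (nat_mul_mem_frobRange l n), add_mem_frobRange hα (nat_mem_frobRange l n)⟩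

/-! ## Prop. 6.13 (i): `ℱ(λ)` is a semiring homomorphism (`∪ ↦ min`, `+ ↦ +`) -/

/-- **`ℱ(λ)` in exponent coordinates** on the positive part: for a finite non-empty
`E ⊂ ℕ × ℕ` (an element `Σ_{(a,b) ∈ E} q^a ⊗ q^b` of `ℤ_min⁺ ⊗_𝔹 ℤ_min⁺ ⊂ Sub(ℤ × ℤ)`),
`ℱ(λ)(E) = inf_{(a,b) ∈ E} L_λ(a,b)`, `L_λ(a,b) = λa + b`. [cite: ConnesConsani2016ArithmeticSite, Prop. 6.13 (i) (proof: "ℱ(λ,q)(E) = q^α, α = inf_{x∈E} L_λ(x)")] -/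
def frobEval (l : ℝ) (E : Finset (ℕ × ℕ)) (hE : E.Nonempty) : ℝ :=
  E.inf' hE fun x => (x.1 : ℝ) * l + x.2

/-- `ℱ(λ)(E) ∈ ℛ(λ)` (the infimum over a finite set is attained). [cite: ConnesConsani2016ArithmeticSite, Prop. 6.13 (ii)] -/
theorem frobEval_mem_frobRange (l : ℝ) (E : Finset (ℕ × ℕ)) (hE : E.Nonempty) :
    frobEval l E hE ∈ frobRange l := by
  obtain ⟨x, -, hx⟩ := E.exists_mem_eq_inf' hE fun x => (x.1 : ℝ) * l + x.2
  exact ⟨x.1, x.2, hx⟩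

/-- **Prop. 6.13 (i), union**: "`inf_{E ∪ E'} L_λ = inf {inf_E L_λ, inf_{E'} L_λ}`".
[cite: ConnesConsani2016ArithmeticSite, Prop. 6.13 (i) (proof)] -/
theorem frobEval_union [DecidableEq (ℕ × ℕ)] (l : ℝ) (E E' : Finset (ℕ × ℕ)) (hE : E.Nonempty)
    (hE' : E'.Nonempty) :
    frobEval l (E ∪ E') (hE.mono Finset.subset_union_left) =
      min (frobEval l E hE) (frobEval l E' hE') := by
  unfold frobEval
  rw [Finset.inf'_union]

open Pointwise in
/-- **Prop. 6.13 (i), sum**: "`inf_{E + E'} L_λ = inf_E L_λ + inf_{E'} L_λ`" (Minkowski sum of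
finite subsets of `ℕ × ℕ`; `L_λ` is additive). [cite: ConnesConsani2016ArithmeticSite, Prop. 6.13 (i) (proof)] -/
theorem frobEval_add [DecidableEq (ℕ × ℕ)] (l : ℝ) (E E' : Finset (ℕ × ℕ)) (hE : E.Nonempty)
    (hE' : E'.Nonempty) :
    frobEval l (E + E') (hE.add hE') = frobEval l E hE + frobEval l E' hE' := by
  unfold frobEval
  refine le_antisymm ?_ ?_
  · obtain ⟨x, hx, hxe⟩ := E.exists_mem_eq_inf' hE fun x => (x.1 : ℝ) * l + x.2
    obtain ⟨y, hy, hye⟩ := E'.exists_mem_eq_inf' hE' fun x => (x.1 : ℝ) * l + x.2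
    rw [hxe, hye]
    refine (Finset.inf'_le _ (Finset.add_mem_add hx hy)).trans (le_of_eq ?_)
    simp only [Prod.fst_add, Prod.snd_add, Nat.cast_add]
    ring
  · refine Finset.le_inf' _ _ fun z hz => ?_
    obtain ⟨x, hx, y, hy, rfl⟩ := Finset.mem_add.1 hz
    have h1 := Finset.inf'_le (fun x : ℕ × ℕ => (x.1 : ℝ) * l + x.2) hx
    have h2 := Finset.inf'_le (fun x : ℕ × ℕ => (x.1 : ℝ) * l + x.2) hy
    simp only [Prod.fst_add, Prod.snd_add, Nat.cast_add] at h1 h2 ⊢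
    linarith

/-! ## Prop. 6.13 (iii): `ℛ(λ) ≅ ℛ(λ')` iff `λ' ∈ {λ, 1/λ}` (irrational `λ, λ'`) -/

/-- A semiring isomorphism `ℛ(λ) ≅ ℛ(λ')` in exponent coordinates: a bijection `S → T` preserving
the multiplication (`+` on exponents) and the addition (`min` on exponents).
[cite: ConnesConsani2016ArithmeticSite, Prop. 6.13 (iii)] -/
def IsMinPlusIso (S T : Set ℝ) (φ : ℝ → ℝ) : Prop :=
  BijOn φ S T ∧ (∀ a ∈ S, ∀ b ∈ S, φ (a + b) = φ a + φ b) ∧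
    ∀ a ∈ S, ∀ b ∈ S, φ (min a b) = min (φ a) (φ b)

/-- Unique representation `α = nλ + m` for irrational `λ`. [cite: ConnesConsani2016ArithmeticSite, Prop. 6.13 (proof of (iii))] -/
theorem frobRange_coeff_unique {l : ℝ} (hl : Irrational l) {n m n' m' : ℕ}
    (h : (n : ℝ) * l + m = n' * l + m') : n = n' ∧ m = m' := by
  by_cases hn : n = n'
  · subst hn
    refine ⟨rfl, ?_⟩
    have : (m : ℝ) = m' := by linarith
    exact_mod_cast this
  · exfalso
    rw [irrational_iff_ne_rational] at hl
    have hneR : (n : ℝ) - n' ≠ 0 := by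
      have : (n : ℝ) ≠ n' := by exact_mod_cast hn
      intro h0; apply this; linarith
    have hb : ((n : ℤ) - n' : ℤ) ≠ 0 := by
      have : (n : ℤ) ≠ n' := by exact_mod_cast hn
      omega
    refine hl ((m' : ℤ) - m) ((n : ℤ) - n') hb ?_
    push_cast
    rw [eq_div_iff hneR]
    linear_combination h

/-- An element `x` of a subset `S ⊂ ℝ` closed under `+` is INDECOMPOSABLE if `x ≠ 0` and
`x = a + b` with `a, b ∈ S` forces `a = 0` or `b = 0` ("indecomposable as products" for `q^x`).
[cite: ConnesConsani2016ArithmeticSite, Prop. 6.13 (proof of (iii))] -/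
def IsIndecomposable (S : Set ℝ) (x : ℝ) : Prop :=
  x ∈ S ∧ x ≠ 0 ∧ ∀ a ∈ S, ∀ b ∈ S, a + b = x → a = 0 ∨ b = 0

/-- Elements of `ℛ(λ)` are `≥ 0`, and a non-zero one is `≥ min(λ, 1)`. [cite: ConnesConsani2016ArithmeticSite, §7.1] -/
theorem frobRange_nonneg {l : ℝ} (hl : 0 < l) {a : ℝ} (ha : a ∈ frobRange l) : 0 ≤ a := by
  obtain ⟨n, m, rfl⟩ := ha
  positivity

/-- **"`X = q^λ`, `Y = q` are the indecomposable elements"**: for irrational `λ > 0`, the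
indecomposables of `(ℕλ + ℕ, +)` are exactly `λ` and `1`. [cite: ConnesConsani2016ArithmeticSite, Prop. 6.13 (proof of (iii))] -/
theorem isIndecomposable_frobRange_iff {l : ℝ} (hl : 0 < l) (hi : Irrational l) {x : ℝ} :
    IsIndecomposable (frobRange l) x ↔ x = l ∨ x = 1 := by
  constructor
  · rintro ⟨⟨n, m, rfl⟩, hx0, hind⟩
    -- split off one generator
    rcases Nat.eq_zero_or_pos n with rfl | hn
    · -- x = m
      rcases Nat.eq_zero_or_pos m with rfl | hm
      · simp at hx0
      · right
        obtain ⟨k, rfl⟩ : ∃ k, m = k + 1 := ⟨m - 1, by omega⟩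
        have h := hind 1 (one_mem_frobRange l) k (nat_mem_frobRange l k) (by push_cast; ring)
        rcases h with h | h
        · exact absurd h one_ne_zero
        · have hk : k = 0 := by exact_mod_cast h
          subst hk; simp
    · obtain ⟨k, rfl⟩ : ∃ k, n = k + 1 := ⟨n - 1, by omega⟩
      have h := hind l (self_mem_frobRange l) ((k : ℝ) * l + m) (mem_frobRange l k m)
        (by push_cast; ring)
      rcases h with h | h
      · exact absurd h hl.ne'
      · left
        have hk : (k : ℝ) * l = 0 ∧ (m : ℝ) = 0 := by
          have h1 : 0 ≤ (k : ℝ) * l := by positivity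
          have h2 : 0 ≤ (m : ℝ) := by positivity
          constructor <;> linarith
        have hk' : (k : ℝ) = 0 := by
          rcases mul_eq_zero.1 hk.1 with h' | h'
          · exact h'
          · exact absurd h' hl.ne'
        rw [show ((k + 1 : ℕ) : ℝ) = k + 1 by push_cast; ring, hk', hk.2]
        ring
  · rintro (rfl | rfl)
    · refine ⟨self_mem_frobRange x, hl.ne', fun a ha b hb hab => ?_⟩
      obtain ⟨n, m, rfl⟩ := ha
      obtain ⟨n', m', rfl⟩ := hb
      have h := frobRange_coeff_unique hi (n := n + n') (m := m + m') (n' := 1) (m' := 0)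
        (by push_cast at hab ⊢; linarith)
      obtain ⟨h1, h2⟩ := h
      have hm : m = 0 := by omega
      have hm' : m' = 0 := by omega
      subst hm; subst hm'
      rcases Nat.eq_zero_or_pos n with rfl | hn
      · left; simp
      · right
        have : n' = 0 := by omega
        subst this; simp
    · refine ⟨one_mem_frobRange l, one_ne_zero, fun a ha b hb hab => ?_⟩
      obtain ⟨n, m, rfl⟩ := ha
      obtain ⟨n', m', rfl⟩ := hb
      have h := frobRange_coeff_unique hi (n := n + n') (m := m + m') (n' := 0) (m' := 1)
        (by push_cast at hab ⊢; linarith)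
      obtain ⟨h1, h2⟩ := h
      have hn : n = 0 := by omega
      have hn' : n' = 0 := by omega
      subst hn; subst hn'
      rcases Nat.eq_zero_or_pos m with rfl | hm
      · left; simp
      · right
        have : m' = 0 := by omega
        subst this; simp

/-- Comparing `X^a` with `Y^b` pins down a real number: if `nx < m ⇒ ny < m` and
`m < nx ⇒ m < ny` for all `n, m ∈ ℕ` (`x, y ≥ 0`) then `x = y` (density of `ℚ`; "one recovers … the
Dedekind cut which defines `λ`"). [cite: ConnesConsani2016ArithmeticSite, Prop. 6.13 (proof of (iii))] -/
theorem eq_of_nat_mul_lt_nat {x y : ℝ} (hx : 0 ≤ x) (hy : 0 ≤ y)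
    (h1 : ∀ n m : ℕ, (n : ℝ) * x < m → (n : ℝ) * y < m)
    (h2 : ∀ n m : ℕ, (m : ℝ) < n * x → (m : ℝ) < n * y) : x = y := by
  -- between `nu < nv` with `n(v-u) > 1` there is an integer
  have key : ∀ {u v : ℝ}, 0 ≤ u → u < v → ∃ n m : ℕ, (n : ℝ) * u < m ∧ (m : ℝ) < n * v := by
    intro u v hu huv
    obtain ⟨n, hn⟩ := exists_nat_gt (1 / (v - u))
    have hn0 : (0 : ℝ) < n := lt_trans (by positivity) hn
    have hgap : (n : ℝ) * u + 1 < n * v := by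
      have : 1 < (n : ℝ) * (v - u) := by
        rw [div_lt_iff₀ (by linarith)] at hn; linarith
      linarith
    refine ⟨n, ⌊(n : ℝ) * u⌋₊ + 1, ?_, ?_⟩
    · push_cast
      exact Nat.lt_floor_add_one _
    · push_cast
      have := Nat.floor_le (mul_nonneg hn0.le hu)
      linarith
  by_contra hne
  rcases lt_or_gt_of_ne hne with hlt | hgt
  · obtain ⟨n, m, hm1, hm2⟩ := key hx hlt
    have := h1 n m hm1
    linarith
  · obtain ⟨n, m, hm1, hm2⟩ := key hy hgt
    have := h2 n m hm2
    linarith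

/-- **Connes–Consani 2016, Proposition 6.13 (iii)**: "The semirings `ℛ(λ)` and `ℛ(λ')`, for
`λ, λ' ∉ ℚ₊*`, are isomorphic if and only if `λ' = λ` or `λ' = 1/λ`" — for irrational
`λ, λ' > 0`, in exponent coordinates (`IsMinPlusIso`). Proof as printed: an isomorphism permutes
the two indecomposables `{λ, 1}`; comparing `X^a` with `Y^b` recovers the Dedekind cut of `λ` (or of
`1/λ` after exchanging the generators); conversely `α ↦ α/λ` is an isomorphism `ℛ(λ) ≅ ℛ(1/λ)`.
[cite: ConnesConsani2016ArithmeticSite, Prop. 6.13 (iii)] -/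
theorem ConnesConsani2016_prop_6_13_iii {l l' : ℝ} (hl : 0 < l) (hl' : 0 < l') (hi : Irrational l)
    (hi' : Irrational l') :
    (∃ φ : ℝ → ℝ, IsMinPlusIso (frobRange l) (frobRange l') φ) ↔ (l' = l ∨ l' = 1 / l) := by
  constructor
  · rintro ⟨φ, hbij, hadd, hmin⟩
    have hS0 := zero_mem_frobRange l
    -- `φ 0 = 0`
    have hφ0 : φ 0 = 0 := by
      have h := hadd 0 hS0 0 hS0
      rw [add_zero] at h
      linarith
    -- `φ` is strictly monotone on `ℛ(λ)`
    have hmono : ∀ a ∈ frobRange l, ∀ b ∈ frobRange l, a < b → φ a < φ b := by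
      intro a ha b hb hab
      have h := hmin a ha b hb
      rw [min_eq_left hab.le] at h
      rcases (min_choice (φ a) (φ b)) with h' | h'
      · have hle : φ a ≤ φ b := by rw [h]; exact min_le_right _ _
        exact lt_of_le_of_ne hle fun heq => hab.ne (hbij.2.1 ha hb heq)
      · rw [h'] at h
        exact absurd (hbij.2.1 ha hb h) hab.ne
    -- `φ` on `nλ + m`
    have hnat : ∀ n m : ℕ, φ ((n : ℝ) * l + m) = n * φ l + m * φ 1 := by
      have h1 : ∀ n : ℕ, φ ((n : ℝ) * l) = n * φ l := by
        intro n
        induction n with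
        | zero => simp [hφ0]
        | succ n ih =>
          rw [show ((n + 1 : ℕ) : ℝ) * l = n * l + l by push_cast; ring,
            hadd _ (nat_mul_mem_frobRange l n) _ (self_mem_frobRange l), ih]
          push_cast; ring
      have h2 : ∀ m : ℕ, φ (m : ℝ) = m * φ 1 := by
        intro m
        induction m with
        | zero => simp [hφ0]
        | succ m ih =>
          rw [show ((m + 1 : ℕ) : ℝ) = (m : ℝ) + 1 by push_cast; ring,
            hadd _ (nat_mem_frobRange l m) _ (one_mem_frobRange l), ih]
          ring
      intro n m
      rw [hadd _ (nat_mul_mem_frobRange l n) _ (nat_mem_frobRange l m), h1, h2]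
    -- `φ` maps indecomposables to indecomposables
    have hind : ∀ x, IsIndecomposable (frobRange l) x → IsIndecomposable (frobRange l') (φ x) := by
      rintro x ⟨hx, hx0, hdec⟩
      refine ⟨hbij.1 hx, fun h0 => hx0 (hbij.2.1 hx hS0 (h0.trans hφ0.symm)), ?_⟩
      intro a' ha' b' hb' hab
      obtain ⟨a, ha, rfl⟩ := hbij.2.2 ha'
      obtain ⟨b, hb, rfl⟩ := hbij.2.2 hb'
      rw [← hadd a ha b hb] at hab
      have := hbij.2.1 (add_mem_frobRange ha hb) hx hab
      rcases hdec a ha b hb this with h | h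
      · left; rw [h, hφ0]
      · right; rw [h, hφ0]
    have hφl := (isIndecomposable_frobRange_iff hl' hi').1
      (hind l ((isIndecomposable_frobRange_iff hl hi).2 (Or.inl rfl)))
    have hφ1 := (isIndecomposable_frobRange_iff hl' hi').1
      (hind 1 ((isIndecomposable_frobRange_iff hl hi).2 (Or.inr rfl)))
    have hl1 : l ≠ 1 := fun h => hi ⟨1, by simp [h]⟩
    have hne : φ l ≠ φ 1 := fun h => hl1 (hbij.2.1 (self_mem_frobRange l) (one_mem_frobRange l) h)
    -- the two cases
    rcases hφl with hL | hL <;> rcases hφ1 with h1 | h1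
    · exact absurd (hL.trans h1.symm) hne
    · -- φ λ = λ', φ 1 = 1: same Dedekind cut
      left
      refine (eq_of_nat_mul_lt_nat hl.le hl'.le (fun n m h => ?_) (fun n m h => ?_)).symm
      · have := hmono _ (nat_mul_mem_frobRange l n) _ (nat_mem_frobRange l m) h
        rw [show ((n : ℝ) * l) = n * l + (0 : ℕ) by simp, hnat,
          show (m : ℝ) = (0 : ℕ) * l + m by simp, hnat, hL, h1] at this
        simpa using this
      · have := hmono _ (nat_mem_frobRange l m) _ (nat_mul_mem_frobRange l n) h
        rw [show ((n : ℝ) * l) = n * l + (0 : ℕ) by simp, hnat,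
          show (m : ℝ) = (0 : ℕ) * l + m by simp, hnat, hL, h1] at this
        simpa using this
    · -- φ λ = 1, φ 1 = λ': the cut of `1/λ'`
      right
      have hcut : l = 1 / l' := by
        refine eq_of_nat_mul_lt_nat hl.le (by positivity) (fun n m h => ?_) (fun n m h => ?_)
        · have := hmono _ (nat_mul_mem_frobRange l n) _ (nat_mem_frobRange l m) h
          rw [show ((n : ℝ) * l) = n * l + (0 : ℕ) by simp, hnat,
            show (m : ℝ) = (0 : ℕ) * l + m by simp, hnat, hL, h1] at this
          simp only [Nat.cast_zero, zero_mul, add_zero, mul_one, zero_add] at this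
          rw [mul_one_div, div_lt_iff₀ hl']
          exact this
        · have := hmono _ (nat_mem_frobRange l m) _ (nat_mul_mem_frobRange l n) h
          rw [show ((n : ℝ) * l) = n * l + (0 : ℕ) by simp, hnat,
            show (m : ℝ) = (0 : ℕ) * l + m by simp, hnat, hL, h1] at this
          simp only [Nat.cast_zero, zero_mul, add_zero, mul_one, zero_add] at this
          rw [mul_one_div, lt_div_iff₀ hl']
          exact this
      rw [hcut, one_div_one_div]
    · exact absurd (hL.trans h1.symm) hne
  · rintro (rfl | rfl)
    · exact ⟨id, ⟨fun x hx => hx, fun x _ y _ h => h, fun x hx => ⟨x, hx, rfl⟩⟩,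
        fun a _ b _ => rfl, fun a _ b _ => rfl⟩
    · -- `α ↦ α/λ : ℛ(λ) ≅ ℛ(1/λ)` (exchange of the generators)
      refine ⟨fun x => x / l, ⟨fun x hx => ?_, fun x _ y _ h => ?_, fun y hy => ?_⟩,
        fun a _ b _ => add_div a b l, fun a _ b _ => (min_div_div_right hl.le a b).symm⟩
      · obtain ⟨n, m, rfl⟩ := hx
        exact ⟨m, n, by field_simp; ring⟩
      · simpa [div_left_inj' hl.ne'] using h
      · obtain ⟨n, m, rfl⟩ := hy
        exact ⟨(m : ℝ) * l + n, mem_frobRange l m n, by field_simp; ring⟩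

end Literature.NumberTheory.ConnesConsani
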